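/-
Width seat `ym-line-cbag-p1-w2` (prover-ym-line-cbag-p1-w2-g12-0; own items stmt-QuantumFields-22254 / 22893 of route `ColdBoxAllGroups`
CLOSED proved).  Glue with a consumer: the SLACK-ABSORPTION step of crux `DensityTransferG` (stmt-QuantumFields-25709) of the planner's LINE 3
`SixPlaneColdBox` — the birth skeleton's stub `stub_slackAbsorptionG` (HOME/bc/DensityTransferG_birth.lean), proved verbatim from the LANDED
cold-box floor for the six-plane density.  RECORD-type node downstream; the Yang–Mills mass gap is NOT proved by anything here.
-/
import Summits.QuantumFields.YangMills.Theses.SixPlaneColdBox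

/-!
# Route `SixPlaneColdBox`, crux `DensityTransferG`: slack absorption

The birth skeleton of crux `DensityTransferG` (`TorusMeanNearColdBoxG → BulkDominatesBoxDensityG`) splits it as
`SixPlaneTransferWithSlackG` (the analytic one-sided DLR transfer for the six-plane density, with an ADDITIVE error `β^{-(8A+m)}` in `β²`
units) followed by `SlackAbsorptionG`: the transfer-with-slack statement implies the route's target `BulkDominatesBoxDensityG` exactly,
because the landed POSITIVE cold-box floor for the density (`ColdBoxAllGroups.boxActionDensityFloor_allGroups`, p601811:
`β²·Cov_box ≥ c·C(⌈β^A⌉)²`, and `C(n)² ≥ κ²/n⁸` by `curvatureCorrPowerFloor_proof`, so `β²·Cov_box ≥ (cκ²/256)·β^{-8A}`) absorbs the slack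
into half the fraction: `η·B − β^{-(8A+m)} ≥ (η/2)·B` as soon as `β^{-m} ≤ ηcκ²/512`.  This file proves that second stub:

* `boxFloor_arith'` (file-local copy of the Assembly file's `boxFloor_arith`, so that the two glue files land independently) and
  `slack_arith` — the absorption inequality with atomised inputs;
* `bulkDominatesBoxDensityG_of_slack` — `SlackAbsorptionG` of the skeleton, verbatim: (transfer with slack, for every compact simple `G`
  and faithful unitary `r`) `→ BulkDominatesBoxDensityG` (fraction `η/2`, same exponents `A, θ`).

Pure bookkeeping on tree theorems; the analytic content of the crux is the OTHER stub (`SixPlaneTransferWithSlackG`), untouched here.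
NOT the Clay mass gap; no summit statement is touched.  No sorry; standard axioms.
-/

set_option autoImplicit false

noncomputable section

open MeasureTheory Filter Topology
open Literature.MathematicalPhysics.QuantumFieldTheory
open Literature.MathematicalPhysics.QuantumLattice
open Summit.QuantumFields.YangMills.Theorems.WeakCouplingRates
open Summit.QuantumFields.YangMills.Theses.SixPlaneColdBox (BulkDominatesBoxDensityG)

namespace Summit.QuantumFields.YangMills.Theorems.SixPlaneColdBox

/-- The box-floor arithmetic, atomised (file-local copy of `SixPlaneColdBox.boxFloor_arith` of the Assembly glue file, kept private so
the two files are independent): with `n = ⌈β^A⌉`, `β ≥ 1`, `κ/n⁴ ≤ |Cn|` and `c·Cn² ≤ B` give `(cκ²/256)·β^{-8A} ≤ B`. -/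
private theorem boxFloor_arith' {A c κ β Cn B : ℝ} (hA : 0 ≤ A) (hc : 0 ≤ c) (hκ : 0 ≤ κ) (hβ : 1 ≤ β)
    (hCn : κ / (⌈β ^ A⌉₊ : ℝ) ^ 4 ≤ |Cn|) (hfloor : c * Cn ^ 2 ≤ B) :
    c * κ ^ 2 / 256 * β ^ (-(8 * A)) ≤ B := by
  -- adapted from `WeakCouplingRates.polySeparationPlaquetteFloor_of_box`
  have hβ0 : 0 < β := one_pos.trans_le hβ
  set n : ℕ := ⌈β ^ A⌉₊ with hndef
  obtain ⟨hn1, hn2⟩ := one_le_ceil_rpow_and_le (A := A) hβ hA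
  have hn0 : (0 : ℝ) < (n : ℝ) := one_pos.trans_le hn1
  have hcn : κ ^ 2 / (n : ℝ) ^ 8 ≤ Cn ^ 2 := by
    have hk0 : 0 ≤ κ / (n : ℝ) ^ 4 := by positivity
    have := mul_self_le_mul_self hk0 hCn
    rw [← sq, ← sq, sq_abs, div_pow] at this
    calc κ ^ 2 / (n : ℝ) ^ 8 = κ ^ 2 / ((n : ℝ) ^ 4) ^ 2 := by ring
      _ ≤ _ := this
  have hβA : 0 < β ^ A := Real.rpow_pos_of_pos hβ0 A
  have hn8 : (n : ℝ) ^ 8 ≤ 256 * (β ^ A) ^ 8 := by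
    have := pow_le_pow_left₀ hn0.le hn2 8
    calc (n : ℝ) ^ 8 ≤ (2 * β ^ A) ^ 8 := this
      _ = 256 * (β ^ A) ^ 8 := by ring
  have hrpow : β ^ (-(8 * A)) = ((β ^ A) ^ 8)⁻¹ := by
    rw [Real.rpow_neg hβ0.le]
    congr 1
    rw [show (8 : ℝ) * A = A * (8 : ℕ) by push_cast; ring, Real.rpow_mul_natCast hβ0.le]
  rw [hrpow]
  calc c * κ ^ 2 / 256 * ((β ^ A) ^ 8)⁻¹ = c * (κ ^ 2 / (256 * (β ^ A) ^ 8)) := by field_simp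
    _ ≤ c * (κ ^ 2 / (n : ℝ) ^ 8) :=
        mul_le_mul_of_nonneg_left (div_le_div_of_nonneg_left (by positivity) (by positivity) hn8) hc
    _ ≤ c * Cn ^ 2 := mul_le_mul_of_nonneg_left hcn hc
    _ ≤ B := hfloor

/-- **Slack absorption, atomised.**  With `n = ⌈β^A⌉`, `β ≥ 1`: `κ/n⁴ ≤ |Cn|`, `c·Cn² ≤ B`, `β^{-m} ≤ ηcκ²/512` and
`η·B − β^{-(8A+m)} ≤ R` give `(η/2)·B ≤ R`. -/
theorem slack_arith {A m c κ η β Cn B R : ℝ} (hA : 0 ≤ A) (hc : 0 ≤ c) (hκ : 0 ≤ κ) (hη : 0 ≤ η) (hβ : 1 ≤ β)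
    (hCn : κ / (⌈β ^ A⌉₊ : ℝ) ^ 4 ≤ |Cn|) (hfloor : c * Cn ^ 2 ≤ B) (hm : β ^ (-m) ≤ η * c * κ ^ 2 / 512)
    (hdom : η * B - β ^ (-(8 * A + m)) ≤ R) :
    η / 2 * B ≤ R := by
  have hβ0 : 0 < β := one_pos.trans_le hβ
  have hB : c * κ ^ 2 / 256 * β ^ (-(8 * A)) ≤ B := boxFloor_arith' hA hc hκ hβ hCn hfloor
  have h8A : 0 ≤ β ^ (-(8 * A)) := (Real.rpow_pos_of_pos hβ0 _).le
  have hslack : β ^ (-(8 * A + m)) ≤ η / 2 * B := by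
    calc β ^ (-(8 * A + m)) = β ^ (-(8 * A)) * β ^ (-m) := by
          rw [show -(8 * A + m) = -(8 * A) + -m by ring, Real.rpow_add hβ0]
      _ ≤ β ^ (-(8 * A)) * (η * c * κ ^ 2 / 512) := mul_le_mul_of_nonneg_left hm h8A
      _ = η / 2 * (c * κ ^ 2 / 256 * β ^ (-(8 * A))) := by ring
      _ ≤ η / 2 * B := mul_le_mul_of_nonneg_left hB (by positivity)
  have : η / 2 * B = η * B - η / 2 * B := by ring
  rw [this]
  linarith

/-- **`SlackAbsorptionG` of the birth skeleton of crux `DensityTransferG`, PROVED** (verbatim): if, for every compact simple `G` and every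
faithful unitary lattice representation `r`, there are `0 < A < θ ≤ 1/100`, `η > 0`, `m > 0` with, for all large `β` and then all large odd
tori `2S+1`, `η·β²·Cov_{box ⌈β^θ⌉}(Σ_q c_q(x_c), Σ_q c_q(x_c+⌈β^A⌉e₀)) − β^{-(8A+m)} ≤ β²·⟨F ; τ_{⌈β^A⌉e₀}F⟩_{β,2S+1}` (`F = actionDensity r.ρ`),
then the route's target `BulkDominatesBoxDensityG` holds (with fraction `η/2` and the same exponents).  Inputs: the landed floor
`boxActionDensityFloor_allGroups`, the kernel floor `curvatureCorrPowerFloor_proof`, `slack_arith`.  Bookkeeping only; NOT the Clay gap. -/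
theorem bulkDominatesBoxDensityG_of_slack
    (h : ∀ (G : Type) [Group G] [TopologicalSpace G] [IsTopologicalGroup G] [CompactSpace G],
      IsCompactSimpleLieGroup G →
        letI : MeasurableSpace G := borel G
        haveI : BorelSpace G := ⟨rfl⟩
        ∀ r : LatticeRep G, ∃ A θ η m : ℝ, 0 < A ∧ A < θ ∧ θ ≤ 1 / 100 ∧ 0 < η ∧ 0 < m ∧
          ∃ β₀ : ℝ, ∀ β : ℝ, β₀ ≤ β → ∃ S₀ : ℕ, ∀ S : ℕ, S₀ ≤ S →
            η * (β ^ 2 *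
                ((∫ U, (∑ q : {q : Fin 4 × Fin 4 // q.1 < q.2}, plaqCostAt r.ρ (boxCentre ⌈β ^ θ⌉₊) q.1.1 q.1.2 U) *
                      (∑ q : {q : Fin 4 × Fin 4 // q.1 < q.2},
                        plaqCostAt r.ρ (boxCentre ⌈β ^ θ⌉₊ + Pi.single 0 (⌈β ^ A⌉₊ : ℤ)) q.1.1 q.1.2 U) ∂(boxState r.ρ β ⌈β ^ θ⌉₊)) -
                  (∫ U, (∑ q : {q : Fin 4 × Fin 4 // q.1 < q.2}, plaqCostAt r.ρ (boxCentre ⌈β ^ θ⌉₊) q.1.1 q.1.2 U)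
                      ∂(boxState r.ρ β ⌈β ^ θ⌉₊)) *
                    (∫ U, (∑ q : {q : Fin 4 × Fin 4 // q.1 < q.2},
                        plaqCostAt r.ρ (boxCentre ⌈β ^ θ⌉₊ + Pi.single 0 (⌈β ^ A⌉₊ : ℤ)) q.1.1 q.1.2 U) ∂(boxState r.ρ β ⌈β ^ θ⌉₊)))) -
                β ^ (-(8 * A + m)) ≤
              β ^ 2 * latticeConnectedCorr r.ρ β (2 * S + 1) (actionDensity r.ρ) (actionDensity r.ρ) ⌈β ^ A⌉₊) :
    BulkDominatesBoxDensityG := by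
  intro G _ _ _ _ hG r
  obtain ⟨A, θ, η, m, hA, hAθ, hθ1, hη, hm, β₀, hdom⟩ := h G hG r
  -- the landed BOX floor for the six-plane density (same exponents)
  obtain ⟨c, hc, β₁, hfloor⟩ :=
    Summit.QuantumFields.YangMills.Theorems.ColdBoxAllGroups.boxActionDensityFloor_allGroups G hG r A θ hA hAθ hθ1
  -- the kernel FLOOR
  have hF : ∃ κ : ℝ, 0 < κ ∧ ∃ n₀ : ℕ, ∀ n : ℕ, n₀ ≤ n → κ / (n : ℝ) ^ 4 ≤
      |Literature.MathematicalPhysics.QuantumFieldTheory.curvaturePlaquetteCorr (d := 4) (by norm_num) (n : ℤ)| :=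
    curvatureCorrPowerFloor_proof
  obtain ⟨κ, hκ, n₀, hF⟩ := hF
  -- thresholds: `n₀ ≤ ⌈β^A⌉₊` and `β^{-m} ≤ ηcκ²/512`
  have hTinf : ∀ᶠ β : ℝ in atTop, (n₀ : ℝ) ≤ (⌈β ^ A⌉₊ : ℝ) := by
    filter_upwards [(tendsto_rpow_atTop hA).eventually_ge_atTop (n₀ : ℝ)] with β hβ
    exact hβ.trans (Nat.le_ceil _)
  obtain ⟨β₃, hβ₃⟩ := eventually_atTop.1 hTinf
  have hminf : ∀ᶠ β : ℝ in atTop, β ^ (-m) ≤ η * c * κ ^ 2 / 512 :=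
    Filter.Tendsto.eventually_le_const (by positivity) (tendsto_rpow_neg_atTop hm)
  obtain ⟨β₄, hβ₄⟩ := eventually_atTop.1 hminf
  refine ⟨A, θ, η / 2, hA, hAθ, hθ1, by positivity, max (max β₀ β₁) (max (max β₃ β₄) 1), fun β hβ => ?_⟩
  have hb₀ : β₀ ≤ β := (le_max_left _ _).trans ((le_max_left _ _).trans hβ)
  have hb₁ : β₁ ≤ β := (le_max_right _ _).trans ((le_max_left _ _).trans hβ)
  have hb₃ : β₃ ≤ β := (le_max_left _ _).trans ((le_max_left _ _).trans ((le_max_right _ _).trans hβ))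
  have hb₄ : β₄ ≤ β := (le_max_right _ _).trans ((le_max_left _ _).trans ((le_max_right _ _).trans hβ))
  have hβ1 : (1 : ℝ) ≤ β := (le_max_right _ _).trans ((le_max_right _ _).trans hβ)
  obtain ⟨S₀, hS₀⟩ := hdom β hb₀
  refine ⟨S₀, fun S hS => ?_⟩
  have hn₀ : n₀ ≤ ⌈β ^ A⌉₊ := by exact_mod_cast hβ₃ β hb₃
  exact slack_arith hA.le hc.le hκ.le hη.le hβ1 (hF ⌈β ^ A⌉₊ hn₀) (hfloor β hb₁) (hβ₄ β hb₄) (hS₀ S hS)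

end Summit.QuantumFields.YangMills.Theorems.SixPlaneColdBox

end
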